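import Summits.HubbardSuperconductivity.HubbardSuperconductivity.Theorems.KacWindowPenaltyGlue
import HarnessLib

/-!
# Crux `WindowInfraredBound` (stmt-HubbardSuperconductivity-1089) — what route `KacWindowPenalty` uses of it:
# the bound AT THE GAP'S OWN POINT `(U, δ)` (pointwise / one-point glue for the planners)

Route `HubbardSuperconductivity/KacWindowPenalty` closes by
`closes (hGap : WindowGap) (hIR : WindowInfraredBound) (hTS : TargetImpliesSummit)`: it takes `(U, δ)` from
`WindowGap` (`∃ U δ, ∀ C ε₀ ∃ ε λ a L₀ …`), instantiates `WindowInfraredBound` (`∀ U δ, ∃ C ε₀ L₀ ∀ ε ≤ ε₀ …`)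
at THAT `(U, δ)` only, and feeds the resulting `(C, ε₀)` back to the gap. The universal scope `∀ (U, δ)` of the
crux is therefore never used by the route: what is consumed is the CONJUNCTION, at one common point, of the
body of `WindowGap` and the body of `WindowInfraredBound`.

This file records that fact as kernel-checked theorems (no definition is introduced; the two bodies are
spelled out verbatim from `Theses/KacWindowPenalty.lean`, so their `let D` / `let W` terms are syntactically
those of `Target`):

* `kacTarget_of_windowGapAt_of_wibAt` — for fixed `U > 0`, `δ ∈ (0, 1/2)`: (body of `WindowGap` at `(U, δ)`)
  → (body of `WindowInfraredBound` at `(U, δ)`) → `KacWindowPenalty.Target` (`σ := C ε`, threshold `max L₀ L₁`;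
  the eight lines of the route's deciding theorem, with the point held fixed);
* `kacSummit_of_windowGapAt_of_wibAt` — hence `HubbardSuperconductivity` (`kacWindowPenalty_targetImpliesSummit_proof`);
* `kacTarget_of_windowPoint`, `kacSummit_of_windowPoint` — the same from the MERGED ONE-POINT statement
  `∃ U > 0, δ ∈ (0, 1/2), (gap body at (U, δ)) ∧ (window-bound body at (U, δ))`, which carries no `∀ (U, δ)`;
* `windowPoint_of_windowGap_of_wib` — the merged one-point statement is implied by the two cruxes as filed
  (so a restatement to it loses nothing the route has, and is strictly weaker in the second conjunct:
  the crux's `∀ (U, δ)` scope — the whole phase-separation refutation surface of the pure model,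
  cf. `not_wib_of_pairPeakWitness` — is dropped).

Planner-facing record (STRATEGY-CENSUS.md §7 R1 for this route; line leads c1–c9): the route-level restatement
of crux 3 for `KacWindowPenalty` that changes NO physics is "`WindowInfraredBound` at `WindowGap`'s own point",
i.e. one item whose signature is the hypothesis of `kacSummit_of_windowPoint` (or two items `WindowGapAt` /
`WindowInfraredBoundAt` sharing an outer `∃ (U, δ)`); `closes` is then `kacSummit_of_windowPoint h` followed by
nothing (the summit is reached directly) or `kacTarget_of_windowPoint h` + `TargetImpliesSummit`. The leak /
uniform-excess variant (weaker tail, reshaped gap) is `kacSummit_of_uniformWindowGap_of_infraredLeak`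
(`Theorems/KacWindowPenaltyWindowInfraredBoundInfraredLeak.lean`). Whether to restate is a planner decision;
this file only certifies the logic. Sources: D. J. Scalapino, Phys. Rep. 250 (1995) 329, §2 (2.4)
[Scalapino1995]; Wang et al., arXiv:2310.05844 §II [WangEtAl2024]. All folklore logic over the tree's glue.
-/

-- the summit namespace repeats the problem name by design (D-0017)
set_option linter.dupNamespace false

namespace Summit.HubbardSuperconductivity.HubbardSuperconductivity.Theorems.WindowInfraredBound

open Summit.HubbardSuperconductivity.HubbardSuperconductivity.Theses

/-- **Gap at `(U, δ)` + window infrared bound at the same `(U, δ)` ⇒ the route target `Target`.**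
For fixed `U > 0`, `δ ∈ (0, 1/2)`: the body of `KacWindowPenalty.WindowGap` at `(U, δ)` (hypothesis `hGap`,
verbatim) and the body of `KacWindowPenalty.WindowInfraredBound` at `(U, δ)` (hypothesis `hWib`, verbatim) give
`Target` with `σ := C ε` and threshold `max L₀ L₁` — the route's deciding theorem with the point held fixed;
the `∀ (U, δ)` of the crux is not used. [folklore] -/
theorem kacTarget_of_windowGapAt_of_wibAt {U δ : ℝ} (hU : 0 < U) (hδ : δ ∈ Set.Ioo (0:ℝ) (1 / 2))
    (hGap : ∀ C : ℝ, 0 ≤ C → ∀ ε₀ : ℝ, 0 < ε₀ → ∃ ε ∈ Set.Ioc (0:ℝ) ε₀, ∃ lam a : ℝ, 0 < lam ∧ 0 < a ∧ ∃ L₀ : ℕ, ∀ (L : ℕ) [NeZero L], L₀ ≤ L → Even L → let D : (Fin 2 → ZMod L) → Matrix (Finset (Literature.MathematicalPhysics.QuantumLattice.Orb (Literature.MathematicalPhysics.QuantumLattice.FermionTorus 2 L))) (Finset (Literature.MathematicalPhysics.QuantumLattice.Orb (Literature.MathematicalPhysics.QuantumLattice.FermionTorus 2 L))) ℂ := fun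 m => ∑ x : Fin 2 → ZMod L, Complex.exp (-(2 * Real.pi * Complex.I * (((∑ i : Fin 2, m i * x i).val : ℕ) : ℂ) / (L : ℂ))) • Literature.MathematicalPhysics.QuantumLattice.localPair Literature.MathematicalPhysics.QuantumLattice.dWaveFormFactor L x; let W : Matrix (Finset (Literature.MathematicalPhysics.QuantumLattice.Orb (Literature.MathematicalPhysics.QuantumLattice.FermionTorus 2 L))) (Finset (Literature.MathematicalPhysics.QuantumLattice.Orb (Literature.MathematicalPhysics.QuantumLattice.FermionTorus 2 L))) ℂ := ∑ m : Fin 2 → ZMod L, if (2 * Real.pi / (L : ℝ)) ^ 2 * (∑ i : Fin 2, (((m i).valMinAbs : ℤ) : ℝ) ^ 2) ≤ ε ^ 2 then ((L : ℂ) ^ 2)⁻¹ • (Matrix.conjTranspose (D m) * D m) else 0; lam * (C * ε + a) * (L : ℝ) ^ 2 ≤ ((Literature.MathematicalPhysics.QuantumLattice.hubbardTorus 2 L 1 U + (lam : ℂ) • W).minEnergyOn (Literature.MathematicalPhysics.QuantumLattice.szSector (2 * ⌊(1 - δ) * (L : ℝ) ^ 2 / 2⌋₊) 0) - (Literature.MathematicalPhysics.QuantumLattice.hubbardTorus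 2 L 1 U).minEnergyOn (Literature.MathematicalPhysics.QuantumLattice.szSector (2 * ⌊(1 - δ) * (L : ℝ) ^ 2 / 2⌋₊) 0)))
    (hWib : ∃ C ε₀ : ℝ, 0 ≤ C ∧ 0 < ε₀ ∧ ∃ L₀ : ℕ, ∀ ε ∈ Set.Ioc (0:ℝ) ε₀, ∀ (L : ℕ) [NeZero L], L₀ ≤ L → Even L → let D : (Fin 2 → ZMod L) → Matrix (Finset (Literature.MathematicalPhysics.QuantumLattice.Orb (Literature.MathematicalPhysics.QuantumLattice.FermionTorus 2 L))) (Finset (Literature.MathematicalPhysics.QuantumLattice.Orb (Literature.MathematicalPhysics.QuantumLattice.FermionTorus 2 L))) ℂ := fun m => ∑ x : Fin 2 → ZMod L, Complex.exp (-(2 * Real.pi * Complex.I * (((∑ i : Fin 2, m i * x i).val : ℕ) : ℂ) / (L : ℂ))) • Literature.MathematicalPhysics.QuantumLattice.localPair Literature.MathematicalPhysics.QuantumLattice.dWaveFormFactor L x; ∀ ψ : Literature.MathematicalPhysics.QuantumLattice.Fock (Literature.MathematicalPhysics.QuantumLattice.Orb (Literature.MathematicalPhysics.QuantumLattice.FermionTorus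 2 L)), star ψ ⬝ᵥ ψ = 1 → Literature.MathematicalPhysics.QuantumLattice.IsGroundStateInSector (Literature.MathematicalPhysics.QuantumLattice.hubbardTorus 2 L 1 U) (2 * ⌊(1 - δ) * (L : ℝ) ^ 2 / 2⌋₊) 0 ψ → (∑ m : Fin 2 → ZMod L, if m ≠ 0 ∧ (2 * Real.pi / (L : ℝ)) ^ 2 * (∑ i : Fin 2, (((m i).valMinAbs : ℤ) : ℝ) ^ 2) ≤ ε ^ 2 then (star (Matrix.mulVec (D m) ψ) ⬝ᵥ Matrix.mulVec (D m) ψ).re / (L : ℝ) ^ 2 else 0) ≤ C * ε * (L : ℝ) ^ 2) :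
    KacWindowPenalty.Target := by
  obtain ⟨C, ε₀, hC, hε₀, L₁, hI⟩ := hWib
  obtain ⟨ε, hε, lam, a, hlam, ha, L₀, hG⟩ := hGap C hC ε₀ hε₀
  refine ⟨U, hU, δ, hδ, ε, lam, C * ε, a, hε.1, hlam, mul_nonneg hC hε.1.le, ha, max L₀ L₁, ?_⟩
  intro L _ hL hEven
  exact ⟨hG L (le_of_max_le_left hL) hEven,
    fun ψ hψ hGS => hI ε hε L (le_of_max_le_right hL) hEven ψ hψ hGS⟩

/-- **Gap at `(U, δ)` + window infrared bound at the same `(U, δ)` ⇒ `HubbardSuperconductivity`**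
(`kacWindowPenalty_targetImpliesSummit_proof ∘ kacTarget_of_windowGapAt_of_wibAt`). [folklore] -/
theorem kacSummit_of_windowGapAt_of_wibAt {U δ : ℝ} (hU : 0 < U) (hδ : δ ∈ Set.Ioo (0:ℝ) (1 / 2))
    (hGap : ∀ C : ℝ, 0 ≤ C → ∀ ε₀ : ℝ, 0 < ε₀ → ∃ ε ∈ Set.Ioc (0:ℝ) ε₀, ∃ lam a : ℝ, 0 < lam ∧ 0 < a ∧ ∃ L₀ : ℕ, ∀ (L : ℕ) [NeZero L], L₀ ≤ L → Even L → let D : (Fin 2 → ZMod L) → Matrix (Finset (Literature.MathematicalPhysics.QuantumLattice.Orb (Literature.MathematicalPhysics.QuantumLattice.FermionTorus 2 L))) (Finset (Literature.MathematicalPhysics.QuantumLattice.Orb (Literature.MathematicalPhysics.QuantumLattice.FermionTorus 2 L))) ℂ := fun m => ∑ x : Fin 2 → ZMod L, Complex.exp (-(2 * Real.pi * Complex.I * (((∑ i : Fin 2, m i * x i).val : ℕ) : ℂ) / (L : ℂ))) • Literature.MathematicalPhysics.QuantumLattice.localPair Literature.MathematicalPhysics.QuantumLattice.dWaveFormFactor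 L x; let W : Matrix (Finset (Literature.MathematicalPhysics.QuantumLattice.Orb (Literature.MathematicalPhysics.QuantumLattice.FermionTorus 2 L))) (Finset (Literature.MathematicalPhysics.QuantumLattice.Orb (Literature.MathematicalPhysics.QuantumLattice.FermionTorus 2 L))) ℂ := ∑ m : Fin 2 → ZMod L, if (2 * Real.pi / (L : ℝ)) ^ 2 * (∑ i : Fin 2, (((m i).valMinAbs : ℤ) : ℝ) ^ 2) ≤ ε ^ 2 then ((L : ℂ) ^ 2)⁻¹ • (Matrix.conjTranspose (D m) * D m) else 0; lam * (C * ε + a) * (L : ℝ) ^ 2 ≤ ((Literature.MathematicalPhysics.QuantumLattice.hubbardTorus 2 L 1 U + (lam : ℂ) • W).minEnergyOn (Literature.MathematicalPhysics.QuantumLattice.szSector (2 * ⌊(1 - δ) * (L : ℝ) ^ 2 / 2⌋₊) 0) - (Literature.MathematicalPhysics.QuantumLattice.hubbardTorus 2 L 1 U).minEnergyOn (Literature.MathematicalPhysics.QuantumLattice.szSector (2 * ⌊(1 - δ) * (L : ℝ) ^ 2 / 2⌋₊) 0)))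
    (hWib : ∃ C ε₀ : ℝ, 0 ≤ C ∧ 0 < ε₀ ∧ ∃ L₀ : ℕ, ∀ ε ∈ Set.Ioc (0:ℝ) ε₀, ∀ (L : ℕ) [NeZero L], L₀ ≤ L → Even L → let D : (Fin 2 → ZMod L) → Matrix (Finset (Literature.MathematicalPhysics.QuantumLattice.Orb (Literature.MathematicalPhysics.QuantumLattice.FermionTorus 2 L))) (Finset (Literature.MathematicalPhysics.QuantumLattice.Orb (Literature.MathematicalPhysics.QuantumLattice.FermionTorus 2 L))) ℂ := fun m => ∑ x : Fin 2 → ZMod L, Complex.exp (-(2 * Real.pi * Complex.I * (((∑ i : Fin 2, m i * x i).val : ℕ) : ℂ) / (L : ℂ))) • Literature.MathematicalPhysics.QuantumLattice.localPair Literature.MathematicalPhysics.QuantumLattice.dWaveFormFactor L x; ∀ ψ : Literature.MathematicalPhysics.QuantumLattice.Fock (Literature.MathematicalPhysics.QuantumLattice.Orb (Literature.MathematicalPhysics.QuantumLattice.FermionTorus 2 L)), star ψ ⬝ᵥ ψ = 1 → Literature.MathematicalPhysics.QuantumLattice.IsGroundStateInSector (Literature.MathematicalPhysics.QuantumLattice.hubbardTorus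 2 L 1 U) (2 * ⌊(1 - δ) * (L : ℝ) ^ 2 / 2⌋₊) 0 ψ → (∑ m : Fin 2 → ZMod L, if m ≠ 0 ∧ (2 * Real.pi / (L : ℝ)) ^ 2 * (∑ i : Fin 2, (((m i).valMinAbs : ℤ) : ℝ) ^ 2) ≤ ε ^ 2 then (star (Matrix.mulVec (D m) ψ) ⬝ᵥ Matrix.mulVec (D m) ψ).re / (L : ℝ) ^ 2 else 0) ≤ C * ε * (L : ℝ) ^ 2) :
    _root_.HubbardSuperconductivity :=
  kacWindowPenalty_targetImpliesSummit_proof (kacTarget_of_windowGapAt_of_wibAt hU hδ hGap hWib)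

/-- **The merged one-point statement ⇒ `Target`.** Hypothesis: `∃ U > 0, δ ∈ (0, 1/2)` such that BOTH the body
of `WindowGap` and the body of `WindowInfraredBound` hold at `(U, δ)` (verbatim bodies; no `∀ (U, δ)` anywhere).
[folklore] -/
theorem kacTarget_of_windowPoint :
    (∃ U : ℝ, 0 < U ∧ ∃ δ ∈ Set.Ioo (0:ℝ) (1 / 2), (∀ C : ℝ, 0 ≤ C → ∀ ε₀ : ℝ, 0 < ε₀ → ∃ ε ∈ Set.Ioc (0:ℝ) ε₀, ∃ lam a : ℝ, 0 < lam ∧ 0 < a ∧ ∃ L₀ : ℕ, ∀ (L : ℕ) [NeZero L], L₀ ≤ L → Even L → let D : (Fin 2 → ZMod L) → Matrix (Finset (Literature.MathematicalPhysics.QuantumLattice.Orb (Literature.MathematicalPhysics.QuantumLattice.FermionTorus 2 L))) (Finset (Literature.MathematicalPhysics.QuantumLattice.Orb (Literature.MathematicalPhysics.QuantumLattice.FermionTorus 2 L))) ℂ := fun m => ∑ x : Fin 2 → ZMod L, Complex.exp (-(2 * Real.pi * Complex.I * (((∑ i : Fin 2, m i * x i).val : ℕ) : ℂ) / (L : ℂ)))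 • Literature.MathematicalPhysics.QuantumLattice.localPair Literature.MathematicalPhysics.QuantumLattice.dWaveFormFactor L x; let W : Matrix (Finset (Literature.MathematicalPhysics.QuantumLattice.Orb (Literature.MathematicalPhysics.QuantumLattice.FermionTorus 2 L))) (Finset (Literature.MathematicalPhysics.QuantumLattice.Orb (Literature.MathematicalPhysics.QuantumLattice.FermionTorus 2 L))) ℂ := ∑ m : Fin 2 → ZMod L, if (2 * Real.pi / (L : ℝ)) ^ 2 * (∑ i : Fin 2, (((m i).valMinAbs : ℤ) : ℝ) ^ 2) ≤ ε ^ 2 then ((L : ℂ) ^ 2)⁻¹ • (Matrix.conjTranspose (D m) * D m) else 0; lam * (C * ε + a) * (L : ℝ) ^ 2 ≤ ((Literature.MathematicalPhysics.QuantumLattice.hubbardTorus 2 L 1 U + (lam : ℂ) • W).minEnergyOn (Literature.MathematicalPhysics.QuantumLattice.szSector (2 * ⌊(1 - δ) * (L : ℝ) ^ 2 / 2⌋₊) 0) - (Literature.MathematicalPhysics.QuantumLattice.hubbardTorus 2 L 1 U).minEnergyOn (Literature.MathematicalPhysics.QuantumLattice.szSector (2 * ⌊(1 - δ) * (L : ℝ)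 ^ 2 / 2⌋₊) 0))) ∧ (∃ C ε₀ : ℝ, 0 ≤ C ∧ 0 < ε₀ ∧ ∃ L₀ : ℕ, ∀ ε ∈ Set.Ioc (0:ℝ) ε₀, ∀ (L : ℕ) [NeZero L], L₀ ≤ L → Even L → let D : (Fin 2 → ZMod L) → Matrix (Finset (Literature.MathematicalPhysics.QuantumLattice.Orb (Literature.MathematicalPhysics.QuantumLattice.FermionTorus 2 L))) (Finset (Literature.MathematicalPhysics.QuantumLattice.Orb (Literature.MathematicalPhysics.QuantumLattice.FermionTorus 2 L))) ℂ := fun m => ∑ x : Fin 2 → ZMod L, Complex.exp (-(2 * Real.pi * Complex.I * (((∑ i : Fin 2, m i * x i).val : ℕ) : ℂ) / (L : ℂ))) • Literature.MathematicalPhysics.QuantumLattice.localPair Literature.MathematicalPhysics.QuantumLattice.dWaveFormFactor L x; ∀ ψ : Literature.MathematicalPhysics.QuantumLattice.Fock (Literature.MathematicalPhysics.QuantumLattice.Orb (Literature.MathematicalPhysics.QuantumLattice.FermionTorus 2 L)), star ψ ⬝ᵥ ψ = 1 → Literature.MathematicalPhysics.QuantumLattice.IsGroundStateInSector (Literature.MathematicalPhysics.QuantumLattice.hubbardTorus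 2 L 1 U) (2 * ⌊(1 - δ) * (L : ℝ) ^ 2 / 2⌋₊) 0 ψ → (∑ m : Fin 2 → ZMod L, if m ≠ 0 ∧ (2 * Real.pi / (L : ℝ)) ^ 2 * (∑ i : Fin 2, (((m i).valMinAbs : ℤ) : ℝ) ^ 2) ≤ ε ^ 2 then (star (Matrix.mulVec (D m) ψ) ⬝ᵥ Matrix.mulVec (D m) ψ).re / (L : ℝ) ^ 2 else 0) ≤ C * ε * (L : ℝ) ^ 2)) →
    KacWindowPenalty.Target := by
  rintro ⟨U, hU, δ, hδ, hGap, hWib⟩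
  exact kacTarget_of_windowGapAt_of_wibAt hU hδ hGap hWib

/-- **The merged one-point statement ⇒ `HubbardSuperconductivity`** — the one-point analogue of the route's
`Assembly` (`kacWindowPenalty_targetImpliesSummit_proof ∘ kacTarget_of_windowPoint`). [folklore] -/
theorem kacSummit_of_windowPoint :
    (∃ U : ℝ, 0 < U ∧ ∃ δ ∈ Set.Ioo (0:ℝ) (1 / 2), (∀ C : ℝ, 0 ≤ C → ∀ ε₀ : ℝ, 0 < ε₀ → ∃ ε ∈ Set.Ioc (0:ℝ) ε₀, ∃ lam a : ℝ, 0 < lam ∧ 0 < a ∧ ∃ L₀ : ℕ, ∀ (L : ℕ) [NeZero L], L₀ ≤ L → Even L → let D : (Fin 2 → ZMod L) → Matrix (Finset (Literature.MathematicalPhysics.QuantumLattice.Orb (Literature.MathematicalPhysics.QuantumLattice.FermionTorus 2 L))) (Finset (Literature.MathematicalPhysics.QuantumLattice.Orb (Literature.MathematicalPhysics.QuantumLattice.FermionTorus 2 L))) ℂ := fun m => ∑ x : Fin 2 → ZMod L, Complex.exp (-(2 * Real.pi * Complex.I * (((∑ i : Fin 2, m i * x i).val : ℕ) : ℂ) /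 (L : ℂ))) • Literature.MathematicalPhysics.QuantumLattice.localPair Literature.MathematicalPhysics.QuantumLattice.dWaveFormFactor L x; let W : Matrix (Finset (Literature.MathematicalPhysics.QuantumLattice.Orb (Literature.MathematicalPhysics.QuantumLattice.FermionTorus 2 L))) (Finset (Literature.MathematicalPhysics.QuantumLattice.Orb (Literature.MathematicalPhysics.QuantumLattice.FermionTorus 2 L))) ℂ := ∑ m : Fin 2 → ZMod L, if (2 * Real.pi / (L : ℝ)) ^ 2 * (∑ i : Fin 2, (((m i).valMinAbs : ℤ) : ℝ) ^ 2) ≤ ε ^ 2 then ((L : ℂ) ^ 2)⁻¹ • (Matrix.conjTranspose (D m) * D m) else 0; lam * (C * ε + a) * (L : ℝ) ^ 2 ≤ ((Literature.MathematicalPhysics.QuantumLattice.hubbardTorus 2 L 1 U + (lam : ℂ) • W).minEnergyOn (Literature.MathematicalPhysics.QuantumLattice.szSector (2 * ⌊(1 - δ) * (L : ℝ) ^ 2 / 2⌋₊) 0) - (Literature.MathematicalPhysics.QuantumLattice.hubbardTorus 2 L 1 U).minEnergyOn (Literature.MathematicalPhysics.QuantumLattice.szSector (2 * ⌊(1 -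 δ) * (L : ℝ) ^ 2 / 2⌋₊) 0))) ∧ (∃ C ε₀ : ℝ, 0 ≤ C ∧ 0 < ε₀ ∧ ∃ L₀ : ℕ, ∀ ε ∈ Set.Ioc (0:ℝ) ε₀, ∀ (L : ℕ) [NeZero L], L₀ ≤ L → Even L → let D : (Fin 2 → ZMod L) → Matrix (Finset (Literature.MathematicalPhysics.QuantumLattice.Orb (Literature.MathematicalPhysics.QuantumLattice.FermionTorus 2 L))) (Finset (Literature.MathematicalPhysics.QuantumLattice.Orb (Literature.MathematicalPhysics.QuantumLattice.FermionTorus 2 L))) ℂ := fun m => ∑ x : Fin 2 → ZMod L, Complex.exp (-(2 * Real.pi * Complex.I * (((∑ i : Fin 2, m i * x i).val : ℕ) : ℂ) / (L : ℂ))) • Literature.MathematicalPhysics.QuantumLattice.localPair Literature.MathematicalPhysics.QuantumLattice.dWaveFormFactor L x; ∀ ψ : Literature.MathematicalPhysics.QuantumLattice.Fock (Literature.MathematicalPhysics.QuantumLattice.Orb (Literature.MathematicalPhysics.QuantumLattice.FermionTorus 2 L)), star ψ ⬝ᵥ ψ = 1 → Literature.MathematicalPhysics.QuantumLattice.IsGroundStateInSector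 (Literature.MathematicalPhysics.QuantumLattice.hubbardTorus 2 L 1 U) (2 * ⌊(1 - δ) * (L : ℝ) ^ 2 / 2⌋₊) 0 ψ → (∑ m : Fin 2 → ZMod L, if m ≠ 0 ∧ (2 * Real.pi / (L : ℝ)) ^ 2 * (∑ i : Fin 2, (((m i).valMinAbs : ℤ) : ℝ) ^ 2) ≤ ε ^ 2 then (star (Matrix.mulVec (D m) ψ) ⬝ᵥ Matrix.mulVec (D m) ψ).re / (L : ℝ) ^ 2 else 0) ≤ C * ε * (L : ℝ) ^ 2)) →
    _root_.HubbardSuperconductivity := fun h =>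
  kacWindowPenalty_targetImpliesSummit_proof (kacTarget_of_windowPoint h)

/-- **The two cruxes as filed imply the merged one-point statement** (take `WindowGap`'s point and
instantiate `WindowInfraredBound` there): a restatement of the route to the one-point form is implied by,
and in its second conjunct strictly weaker than, the current pair `WindowGap ∧ WindowInfraredBound`.
[folklore] -/
theorem windowPoint_of_windowGap_of_wib :
    KacWindowPenalty.WindowGap → KacWindowPenalty.WindowInfraredBound →
    (∃ U : ℝ, 0 < U ∧ ∃ δ ∈ Set.Ioo (0:ℝ) (1 / 2), (∀ C : ℝ, 0 ≤ C → ∀ ε₀ : ℝ, 0 < ε₀ → ∃ ε ∈ Set.Ioc (0:ℝ) ε₀, ∃ lam a : ℝ, 0 < lam ∧ 0 < a ∧ ∃ L₀ : ℕ, ∀ (L : ℕ) [NeZero L], L₀ ≤ L → Even L → let D : (Fin 2 → ZMod L) → Matrix (Finset (Literature.MathematicalPhysics.QuantumLattice.Orb (Literature.MathematicalPhysics.QuantumLattice.FermionTorus 2 L))) (Finset (Literature.MathematicalPhysics.QuantumLattice.Orb (Literature.MathematicalPhysics.QuantumLattice.FermionTorus 2 L))) ℂ := fun m => ∑ x : Fin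 2 → ZMod L, Complex.exp (-(2 * Real.pi * Complex.I * (((∑ i : Fin 2, m i * x i).val : ℕ) : ℂ) / (L : ℂ))) • Literature.MathematicalPhysics.QuantumLattice.localPair Literature.MathematicalPhysics.QuantumLattice.dWaveFormFactor L x; let W : Matrix (Finset (Literature.MathematicalPhysics.QuantumLattice.Orb (Literature.MathematicalPhysics.QuantumLattice.FermionTorus 2 L))) (Finset (Literature.MathematicalPhysics.QuantumLattice.Orb (Literature.MathematicalPhysics.QuantumLattice.FermionTorus 2 L))) ℂ := ∑ m : Fin 2 → ZMod L, if (2 * Real.pi / (L : ℝ)) ^ 2 * (∑ i : Fin 2, (((m i).valMinAbs : ℤ) : ℝ) ^ 2) ≤ ε ^ 2 then ((L : ℂ) ^ 2)⁻¹ • (Matrix.conjTranspose (D m) * D m) else 0; lam * (C * ε + a) * (L : ℝ) ^ 2 ≤ ((Literature.MathematicalPhysics.QuantumLattice.hubbardTorus 2 L 1 U + (lam : ℂ) • W).minEnergyOn (Literature.MathematicalPhysics.QuantumLattice.szSector (2 * ⌊(1 - δ) * (L : ℝ) ^ 2 / 2⌋₊) 0) - (Literature.MathematicalPhysics.QuantumLattice.hubbardTorus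 2 L 1 U).minEnergyOn (Literature.MathematicalPhysics.QuantumLattice.szSector (2 * ⌊(1 - δ) * (L : ℝ) ^ 2 / 2⌋₊) 0))) ∧ (∃ C ε₀ : ℝ, 0 ≤ C ∧ 0 < ε₀ ∧ ∃ L₀ : ℕ, ∀ ε ∈ Set.Ioc (0:ℝ) ε₀, ∀ (L : ℕ) [NeZero L], L₀ ≤ L → Even L → let D : (Fin 2 → ZMod L) → Matrix (Finset (Literature.MathematicalPhysics.QuantumLattice.Orb (Literature.MathematicalPhysics.QuantumLattice.FermionTorus 2 L))) (Finset (Literature.MathematicalPhysics.QuantumLattice.Orb (Literature.MathematicalPhysics.QuantumLattice.FermionTorus 2 L))) ℂ := fun m => ∑ x : Fin 2 → ZMod L, Complex.exp (-(2 * Real.pi * Complex.I * (((∑ i : Fin 2, m i * x i).val : ℕ) : ℂ) / (L : ℂ))) • Literature.MathematicalPhysics.QuantumLattice.localPair Literature.MathematicalPhysics.QuantumLattice.dWaveFormFactor L x; ∀ ψ : Literature.MathematicalPhysics.QuantumLattice.Fock (Literature.MathematicalPhysics.QuantumLattice.Orb (Literature.MathematicalPhysics.QuantumLattice.FermionTorus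 2 L)), star ψ ⬝ᵥ ψ = 1 → Literature.MathematicalPhysics.QuantumLattice.IsGroundStateInSector (Literature.MathematicalPhysics.QuantumLattice.hubbardTorus 2 L 1 U) (2 * ⌊(1 - δ) * (L : ℝ) ^ 2 / 2⌋₊) 0 ψ → (∑ m : Fin 2 → ZMod L, if m ≠ 0 ∧ (2 * Real.pi / (L : ℝ)) ^ 2 * (∑ i : Fin 2, (((m i).valMinAbs : ℤ) : ℝ) ^ 2) ≤ ε ^ 2 then (star (Matrix.mulVec (D m) ψ) ⬝ᵥ Matrix.mulVec (D m) ψ).re / (L : ℝ) ^ 2 else 0) ≤ C * ε * (L : ℝ) ^ 2)) := by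
  rintro ⟨U, hU, δ, hδ, hG⟩ hI
  exact ⟨U, hU, δ, hδ, hG, hI U hU δ hδ⟩

end Summit.HubbardSuperconductivity.HubbardSuperconductivity.Theorems.WindowInfraredBound
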